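import Summits.BirchSwinnertonDyer.BirchSwinnertonDyer.Theorems.GenusKolyvaginAtTwoK4NegBetaFrameDeepPrimeSupply
import HarnessLib

/-!
# Route `GenusKolyvaginAtTwo`, crux K₄⁻ `K4Neg` (stmt-BirchSwinnertonDyer-31526), the (β)-residual F4ᶠ —
# THE (β)-SUPPLY ONE LEVEL UP, TURNKEY: the canonical subgroup `Γ_{K(E[4], V[4], Q')}` and the frame form

Width seat `bsd-line-gk2-p5` g43 (cell `bsd-f1-sign2`), WIDTH-5 attach on route `GenusKolyvaginAtTwo` rev 59, lane «the (β)-residual of K₄⁻».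
`--supports stmt-BirchSwinnertonDyer-31526 --as helper`.  THEOREMS ONLY (no definition, no named fact, no `sorry`); standard axioms.
**BSD is NOT proved by this file; `K4Neg` is NOT proved; no item is closed by it.**

`…BetaFrameDeepPrimeSupply.exists_kolyvaginPrime_deep_sq_smul_sub_ne` (gk2-p5 g43, p792420) supplies deep `FrobEqFrobInfty` Kolyvagin primes at
which the level-`4` Kummer class of a quarter of an entangled half is alive, for an ABSTRACT open conjugation-stable subgroup `H ≤ Γ_ℚ`.  This file
instantiates `H` with the canonical choice and leaves only frame data as hypotheses:

* §1 `H₀ := Γ_{ℚ(W[4])} ⊓ Γ_{ℚ(V[4])} ⊓ Γ_K ⊓ Stab(Q')` — as the subgroup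
  `torsionFixing W 4 ⊓ torsionFixing V 4 ⊓ (absGaloisRestrict ℚ K).range ⊓ stabilizer Q'`: it is OPEN (`isOpen_inf_stabilizer`), CONJUGATION-STABLE
  when `R = 2Q'` is `Γ_ℚ`-fixed (`conj_mem_inf_stabilizer`: the stabiliser part is normalised because `σ⁻¹Q' − Q' ∈ V[2]`), and its elements fix
  `W[4]`, the `4`-division points of `V`, `K` and `Q'`.
* §2 ★★★ `exists_kolyvaginPrime_deep_sq_smul_sub_ne_of_frame` — **THE SUPPLY, FRAME FORM.**  Inputs: `W/ℚ` globally minimal with conductor `≠ 0`,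
  `V/ℚ` elliptic with `ρ̄_{V,2}` onto and `Δ_V < 0` (e.g. `V = Wd`, the twin, whose `Δ` has the sign of `Δ_W`), `K` imaginary quadratic, `c₀` a complex
  conjugation; `R ∈ V(ℚ̄)^{Γ_ℚ}` (the twin's generator), `2Q' = R`, `2Q = Q'`; the (β) ENTANGLEMENT «every element of `Γ_{K(W[4],V[4])}` fixes `Q'`»;
  and ONE element of `Γ_{K(W[4],V[4])}` moving `Q` («`R` is not `4`-divisible over `K(W[4],V[4])`» — the `K`-side form is unconditional on a
  non-halvable `K`-point, gk2-p5 g43 `OneBitDescent.forall_exists_torsionFixing_smul_ne_of_not_two_dvd`).  Output: beyond every bound a prime `ℓ` with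
  `Zhang2014.IsKolyvaginPrime (W.conductorNorm ℤ) W K 2 ℓ ∧ 2 ≤ kolyvaginIndex W 2 ℓ ∧ FrobEqFrobInfty W K 4 ℓ` and a Frobenius `h` at `ℓ`, `h = c₀` on
  `W[4]`, with `h·h·Q − Q ≠ 0`.

READING (census; nothing closed).  With gk2-p4 g35's `mem_torsionFixing_twist_iff_of_smul_geomSqrt_eq` (`Γ_{K(Wd[4])} = Γ_{K(E[4])}`) the subgroup
`H₀` for `V = Wd` is `Γ_{K(E[4])} ∩ Stab Q'`, i.e. the entanglement hypothesis is literally the (β)-frame bit.  BSD is NOT proved by any of this.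

References: [McCallumLMS1991] §3 Cor. 3.2; [GrossLMS1991] §3, §9; [MazurRubin2010] Lemma 3.5; [LawsonWuthrich2016] §7.1; [WZhang2014] Notations (xii).
-/

set_option linter.dupNamespace false -- `Summit.<P>.<Sub>` repeats `BirchSwinnertonDyer` (D-0017)
set_option autoImplicit false

noncomputable section

open scoped Classical Pointwise

namespace Summit.BirchSwinnertonDyer.BirchSwinnertonDyer.Theorems.GenusExact.Lw2PhantomExclusion.DeepPrimeOneBit

open WeierstrassCurve Field NumberField IsDedekindDomain
open Literature.NumberTheory.GaloisRepresentations Literature.NumberTheory.EllipticCurves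
open Literature.NumberTheory
open Rat.HeightOneSpectrum
open Summit.BirchSwinnertonDyer.BirchSwinnertonDyer.Theorems.GenusKolyTwistingPrime

/-! ## §1 The canonical subgroup `Γ_{ℚ(W[4])} ⊓ Γ_{ℚ(V[4])} ⊓ Γ_K ⊓ Stab(Q')` -/

variable (W : WeierstrassCurve ℚ) [W.IsElliptic] (V : WeierstrassCurve ℚ) [V.IsElliptic] (K : Type) [Field K] [NumberField K]

/-- **`Γ_K ≤ Γ_ℚ` (the range of `absGaloisRestrict`) is open** (closed of finite index). [folklore] -/
theorem isOpen_range_absGaloisRestrict :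
    IsOpen (((absGaloisRestrict ℚ K).range : Subgroup (absoluteGaloisGroup ℚ)) : Set (absoluteGaloisGroup ℚ)) := by
  have h : ((absGaloisRestrict ℚ K).range : Set (absoluteGaloisGroup ℚ)) = Set.range (absGaloisRestrict ℚ K) := by
    ext; simp
  rw [h, ← Set.image_univ]
  exact isOpenMap_absGaloisRestrict K _ isOpen_univ

/-- **The canonical subgroup is OPEN.** [folklore] -/
theorem isOpen_inf_stabilizer (Q' : geomPoints V) :
    IsOpen ((torsionFixing W ((2 ^ 2 : ℕ) : ℤ) ⊓ torsionFixing V (4 : ℤ) ⊓ (absGaloisRestrict ℚ K).range ⊓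
      MulAction.stabilizer (absoluteGaloisGroup ℚ) Q' : Subgroup (absoluteGaloisGroup ℚ)) : Set (absoluteGaloisGroup ℚ)) := by
  rw [Subgroup.coe_inf, Subgroup.coe_inf, Subgroup.coe_inf]
  refine ((IsOpen.inter ?_ ?_).inter (isOpen_range_absGaloisRestrict K)).inter (V.isOpen_stabilizer_point_holds Q')
  · exact isOpen_torsionFixing W (by positivity)
  · exact isOpen_torsionFixing V (by norm_num)

omit [W.IsElliptic] [V.IsElliptic] in
/-- **The canonical subgroup is CONJUGATION-STABLE** when `R = 2Q'` is fixed by `Γ_ℚ`: the torsion-fixing parts and `Γ_K` are normal, and for `γ`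
fixing the `4`-division points of `V` and `Q'`, `σγσ⁻¹` fixes `Q'` (`σ⁻¹Q' − Q'` is killed by `2`). [cite: GrossLMS1991, §9 (pairing after Prop. 9.1)] -/
theorem conj_mem_inf_stabilizer (hK : IsImaginaryQuadratic K) {R Q' : geomPoints V} (hR : ∀ σ : absoluteGaloisGroup ℚ, σ • R = R)
    (hQ' : (2 : ℤ) • Q' = R) (σ γ : absoluteGaloisGroup ℚ)
    (hγ : γ ∈ torsionFixing W ((2 ^ 2 : ℕ) : ℤ) ⊓ torsionFixing V (4 : ℤ) ⊓ (absGaloisRestrict ℚ K).range ⊓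
      MulAction.stabilizer (absoluteGaloisGroup ℚ) Q') :
    σ * γ * σ⁻¹ ∈ torsionFixing W ((2 ^ 2 : ℕ) : ℤ) ⊓ torsionFixing V (4 : ℤ) ⊓ (absGaloisRestrict ℚ K).range ⊓
      MulAction.stabilizer (absoluteGaloisGroup ℚ) Q' := by
  obtain ⟨⟨⟨hγW, hγV⟩, hγK⟩, hγQ'⟩ := hγ
  have hHi := index_range_absGaloisRestrict_eq_finrank ℚ K
  haveI hRn : ((absGaloisRestrict ℚ K).range).Normal := Subgroup.normal_of_index_eq_two (hHi.trans hK.1)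
  have hγ4 : ∀ P : geomPoints V, (4 : ℤ) • P = 0 → γ • P = P := fun P hP ↦ by
    have := smul_eq_of_mem_torsionFixing V (4 : ℤ) hγV ⟨P, (WeierstrassCurve.mem_geomTorsion_iff V (4 : ℤ) P).mpr hP⟩
    simpa only [AddSubgroup.torsionBy.coe_smul] using congrArg Subtype.val this
  -- a half `Q` of `Q'` exists in `V(ℚ̄)`; only its existence is used, through `conj_smul_sub_eq`
  obtain ⟨Q, hQ⟩ := V.zsmul_geomPoints_surjective_of_charZero (two_ne_zero) Q'
  obtain ⟨-, hQ'fix, -⟩ := conj_smul_sub_eq V hγ4 hQ' hQ hγQ' (hR σ)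
  exact ⟨⟨⟨(torsionFixing_normal W _).conj_mem γ hγW σ, (torsionFixing_normal V _).conj_mem γ hγV σ⟩, hRn.conj_mem γ hγK σ⟩, hQ'fix⟩

/-! ## §2 ★★★ The supply, frame form -/

/-- ★★★ **THE (β)-SUPPLY ONE LEVEL UP — FRAME FORM.**  `W/ℚ` globally minimal, `V/ℚ` elliptic with `ρ̄_{V,2}` onto and `Δ_V < 0`, `K` imaginary
quadratic, `c₀` a complex conjugation; `R ∈ V(ℚ̄)` fixed by `Γ_ℚ`, `2Q' = R`, `2Q = Q'`; (β): every element of `Γ_ℚ` fixing `W[4]`, the `4`-division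
points of `V` and `K` fixes `Q'`; and some such element moves `Q`.  Then beyond every bound `b` there is a prime `ℓ` with
`Zhang2014.IsKolyvaginPrime (W.conductorNorm ℤ) W K 2 ℓ`, `2 ≤ kolyvaginIndex W 2 ℓ`, `FrobEqFrobInfty W K 4 ℓ`, and an arithmetic Frobenius `h` at `ℓ`
acting on `W[4]` as `c₀` with **`h·h·Q − Q ≠ 0`**.  BSD / `K4Neg` NOT proved by this. [cite: McCallumLMS1991, §3 Cor. 3.2] [cite: GrossLMS1991, §3 (3.2)–(3.3), §9 Prop. 9.6]
[cite: MazurRubin2010, Lemma 3.5] [cite: WZhang2014, Notations (xii)] -/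
theorem exists_kolyvaginPrime_deep_sq_smul_sub_ne_of_frame [W.IsGloballyMinimal] [NeZero (W.conductorNorm ℤ)]
    (hK : IsImaginaryQuadratic K) (hsurjV : V.HasSurjectiveModNGaloisRep 2) (hΔV : V.Δ < 0)
    {c₀ : absoluteGaloisGroup ℚ} (hc₀ : IsComplexConjugation (Rat.castHom ℝ) c₀)
    {R Q' Q : geomPoints V} (hR : ∀ σ : absoluteGaloisGroup ℚ, σ • R = R) (hQ' : (2 : ℤ) • Q' = R) (hQ : (2 : ℤ) • Q = Q')
    (hent : ∀ γ : absoluteGaloisGroup ℚ, γ ∈ torsionFixing W ((2 ^ 2 : ℕ) : ℤ) → γ ∈ torsionFixing V (4 : ℤ) →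
      (∀ x : K, γ • absEmbedding ℚ K x = absEmbedding ℚ K x) → γ • Q' = Q')
    (hN : ∃ γ₀ : absoluteGaloisGroup ℚ, γ₀ ∈ torsionFixing W ((2 ^ 2 : ℕ) : ℤ) ∧ γ₀ ∈ torsionFixing V (4 : ℤ) ∧
      (∀ x : K, γ₀ • absEmbedding ℚ K x = absEmbedding ℚ K x) ∧ γ₀ • Q ≠ Q) (b : ℕ) :
    ∃ ℓ : ℕ, b < ℓ ∧ Zhang2014.IsKolyvaginPrime (W.conductorNorm ℤ) W K 2 ℓ ∧ 2 ≤ Zhang2014.kolyvaginIndex W 2 ℓ ∧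
      FrobEqFrobInfty W K (2 ^ 2) ℓ ∧
      ∃ (v : HeightOneSpectrum (𝓞 ℚ)) (𝔓 : Ideal (absIntegers (𝓞 ℚ) ℚ)) (h : absoluteGaloisGroup ℚ),
        (ℓ : 𝓞 ℚ) ∈ v.asIdeal ∧ 𝔓 ∈ v.primesAbove ∧ IsArithFrobAt (𝓞 ℚ) h 𝔓 ∧
        (∀ P : geomTorsion W ((2 ^ 2 : ℕ) : ℤ), h • P = c₀ • P) ∧ h • h • Q - Q ≠ 0 := by
  set H : Subgroup (absoluteGaloisGroup ℚ) := torsionFixing W ((2 ^ 2 : ℕ) : ℤ) ⊓ torsionFixing V (4 : ℤ) ⊓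
    (absGaloisRestrict ℚ K).range ⊓ MulAction.stabilizer (absoluteGaloisGroup ℚ) Q' with hHdef
  -- `c₀` moves a point of `V(ℚ̄)` killed by `2` (`Δ_V < 0`)
  have hce : ∃ e : geomPoints V, (2 : ℤ) • e = 0 ∧ c₀ • e ≠ e := by
    obtain ⟨e, he⟩ := KolyvaginEigenTwo.exists_twoTorsion_smul_ne_of_Δ_neg V hΔV hc₀
    refine ⟨e, (WeierstrassCurve.mem_geomTorsion_iff V (2 : ℤ) _).mp e.2, fun hcon ↦ he (Subtype.ext ?_)⟩
    rw [AddSubgroup.torsionBy.coe_smul]; exact hcon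
  -- no non-zero `Γ_ℚ`-fixed `2`-torsion on `V`
  have hirr : ∀ m : geomPoints V, (2 : ℤ) • m = 0 → m ≠ 0 → ∃ σ : absoluteGaloisGroup ℚ, σ • m ≠ m := by
    intro m hm hm0
    by_contra hcon
    push Not at hcon
    have hmT : m ∈ geomTorsion V (2 : ℤ) := (WeierstrassCurve.mem_geomTorsion_iff V (2 : ℤ) m).mpr hm
    have h0 : (⟨m, hmT⟩ : geomTorsion V (2 : ℤ)) = 0 :=
      eq_zero_of_forall_smul_eq V hsurjV fun σ ↦ Subtype.ext (by rw [AddSubgroup.torsionBy.coe_smul]; exact hcon σ)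
    exact hm0 (by simpa using congrArg Subtype.val h0)
  -- the hypotheses of the abstract supply for `H`
  have hK' : ∀ γ : absoluteGaloisGroup ℚ, γ ∈ (absGaloisRestrict ℚ K).range ↔ ∀ x : K, γ • absEmbedding ℚ K x = absEmbedding ℚ K x :=
    fun γ ↦ mem_range_absGaloisRestrict_iff_smul_absEmbedding (F := ℚ) (M := K) γ
  have hHW : ∀ γ ∈ H, ∀ P : geomTorsion W ((2 ^ 2 : ℕ) : ℤ), γ • P = P := fun γ hγ P ↦
    smul_eq_of_mem_torsionFixing W _ hγ.1.1.1 P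
  have hHV : ∀ γ ∈ H, ∀ P : geomPoints V, (4 : ℤ) • P = 0 → γ • P = P := fun γ hγ P hP ↦ by
    have := smul_eq_of_mem_torsionFixing V (4 : ℤ) hγ.1.1.2 ⟨P, (WeierstrassCurve.mem_geomTorsion_iff V (4 : ℤ) P).mpr hP⟩
    simpa only [AddSubgroup.torsionBy.coe_smul] using congrArg Subtype.val this
  have hHK : ∀ γ ∈ H, ∀ x : K, γ • absEmbedding ℚ K x = absEmbedding ℚ K x := fun γ hγ ↦ (hK' γ).mp hγ.1.2
  have hHQ' : ∀ γ ∈ H, γ • Q' = Q' := fun γ hγ ↦ hγ.2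
  have hHn : ∀ (σ : absoluteGaloisGroup ℚ), ∀ γ ∈ H, σ * γ * σ⁻¹ ∈ H := fun σ γ hγ ↦
    conj_mem_inf_stabilizer W V K hK hR hQ' σ γ hγ
  have hN' : ∃ γ₀ ∈ H, γ₀ • Q ≠ Q := by
    obtain ⟨γ₀, h1, h2, h3, h4⟩ := hN
    exact ⟨γ₀, ⟨⟨⟨h1, h2⟩, (hK' γ₀).mpr h3⟩, hent γ₀ h1 h2 h3⟩, h4⟩
  exact exists_kolyvaginPrime_deep_sq_smul_sub_ne W V hK hc₀ hce hR hQ' hQ (isOpen_inf_stabilizer W V K Q') hHn hHW hHV hHK hHQ' hN' hirr b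

end Summit.BirchSwinnertonDyer.BirchSwinnertonDyer.Theorems.GenusExact.Lw2PhantomExclusion.DeepPrimeOneBit

end
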